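import Summits.QuantumFields.YangMills.Theorems.BalabanUVNodesSpineReadingOfRecord13CoPHV
import Literature.MathematicalPhysics.QuantumFieldTheory.Balaban1983to89.Node00.TwoRunSiteWindow

/-!
# THE SPINE READING OF RECORD WITH A KEY-READING DIAL — `YMDAG.UVSplit.crOfRecord₁₃K` (edition `K` of `crOfRecord₁₃ ∕ crOfRecord₁₃V`): the SAME runs, keys,
# fine class set and fine class weights of record READ AT A COARSER KEY `kr` (class set = image, class weights = node U5d's partial sums
# `T4MatchingAssembly.classVal` of `weightA₁₃ ∕ weightB₁₃` along `kr`), the bad class read AT THE COARSE KEY by a predicate reading `bd`, the shell split at the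
# reading's key, CANONICAL weights ∕ rate; the pinned record `crOfRecord₁₃VAt K₀ jcut sh` is its IDENTITY-DIAL instance (§5), the level window of
# `Node00/TwoRunSiteWindow` the dial's first non-trivial VALUE (§6)

Cell `pub-ymgap`, YM-PLAN Track A (HUMAN RULING D-0062; width push D-0149); seat `pub-ymgap-dag-n20-d` (R134 (a) N20 NE7b s3 = the U5d ∕ `crOfRecord₁₃` lineage;
plan g78 WORD-CR13 «`crOfRecord₁₃` has ONE declarer = dag-n20-d») gen 29.  `--kind definition --supports stmt-QuantumFields-20544 --as helper`; COUNT-NEUTRAL; v1.0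
(p587226 ∕ p589642) and the V edition (p590105) UNTOUCHED (editions, never mutations).
THE ASK.  K3⁷ `SpineGivenEndpointR13SepCoPH` (stmt-QuantumFields-20544), skeleton v5 941dddb108cbaacf, stub 2 `stub_expansion13H`: `PinnedAtLive jc sh cr` PINS the class
key of the four K5 faces to the σ-packed FULL (2.18) history (`cr = crOfRecord₁₃V (jc …) sh` on the live-selector line).  The crux card
`Cruxes/SpineGivenEndpointR13SepCoPH/Ideas/window-key-core.md` (idea-3 g8; CRIT-1 triage (1) «the proposed key-reading dial gets a VALUE»; § «What it needs» P3 «stub 2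
needs a KEY-READING dial») and dag-n19-w1's `…/N19W1-STUB2-N19PRIME-READING.md` §2 («a key-reading dial `kr` beside `jc`∕`sh` would let a proof that produces `Core` at a
coarser key plug without paying `Fib`»; §6: the record objects are the declarer's) ask for the OBJECT such a dial pins to.  This file is that object and nothing else:
per tuple `(F, θ, hP, g₀, os)` and step `K`, `kr … K` is an ENDO-map of `Σ K, SiteSeqKey F (K₀ + K)` (a coarsening of node U5d's σ-packed coupling-free key) and
`bd … K` a predicate on keys (the bad class at the coarse key, generalising `badClass₁₃`'s level policy `jcut`); `l₀ := 1`, `vol := F.side ^ 4`.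
PROVED (bookkeeping, [folklore] finite sums): §2 dictionary (`rfl`); §3 ★ re-keying preserves the totals (`sum_weightAK₁₃_eq ∕ sum_weightBK₁₃_eq`, `sum_classVal`) ⇒
★★ `keyedExtraction_crOfRecord₁₃KAt` — E1 ∕ E2 AT EVERY KEY READING under the live-selector pin + B‴'s three laws (the V edition's hypotheses verbatim): the
extraction face survives ANY dial; the bad mass at the coarse key = the fine mass of the keys whose coarse key is bad (`sum_bad_weightAK₁₃_eq`, what an NE7b estimate at
a coarse key books); §4 face transfers (canonical weights inherit any witness at the coarse carriers); §5 ★ `crOfRecord₁₃KAt K₀ (keyReadingId₁₃ N K₀) (badKeyReadingOfCut₁₃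
N K₀ jcut) sh = crOfRecord₁₃VAt K₀ jcut sh` (a v6 pin-with-dial has v5's pin as an instance); §6 `windowKeyReading₁₃ K₀ c` (floor `c … K` per tuple and step,
`Node00.windowKeySigma`): floor `0` is the identity dial, and ★ a level cut AT OR BELOW THE FLOOR BOOKS NOTHING (`bad_window_eq_empty_of_cut_le_floor`).
HONEST FRAMING.  A DEFINITION of a reading + bookkeeping; NO estimate; descent ∕ ascent of `Core` ∕ `HybridNE7` along the dial is dag-n19-w1's calculus (p593255 ∕
p601591, cited not re-typed); window series budgets are dag-n20-w3's `…N20WindowKeyBudget`; the card's (YG)∕(AC) NOT touched, (XG) NOT decided; the window value is the LEVEL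
window, NOT Bałaban's region-relative `K(Z)` of [LF-II] (1.80) (see `Node00/TwoRunSiteWindow`); nothing of Bałaban's asserted; NE7 ∕ NE7b ∕ NE7c NOT PRINTED for d = 4 ∕
NOT proved; no `Provisos₁₃CoPH` inhabitant claimed (K0⁷ OPEN); no stub of K3⁷ closed or claimed; N19 ∕ N20 ∕ N21 ∕ N27 NOT discharged; counts UNMOVED (typed 28∕28 ·
discharged 5∕27); one finite four-torus programme at fixed `ε` — NOT ℝ⁴, NOT OS, NOT a mass gap, NOT the Clay problem.  No decl below carries a cite tag.
-/

noncomputable section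

open scoped BigOperators
open Finset

namespace YMDAG.UVSplit
open Literature.MathematicalPhysics.QuantumFieldTheory.Balaban1983to89
open Literature.MathematicalPhysics.QuantumFieldTheory.Balaban1983to89.T4Continuum
open Literature.MathematicalPhysics.QuantumFieldTheory.Balaban1983to89.Node00
open T4WeightBudget (RelWeightBound)
open T4IndicatorShell (ShellWeightBound)
open T4ContinuumYM4Torus (ForSmallCouplings)
open T4MatchingAssembly (classVal sum_classVal classVal_nonneg sum_classVal_eq_filter)
open Summit.QuantumFields.BalabanUV.T4Continuum.Spine
open Summit.QuantumFields.YangMills.BalabanUVNodes.SpineCanonicalWeights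
variable {F : T4Family} {N : ℕ} [NeZero N]

/-! ## §1 The dial types, the coarse carriers, the reading -/
/-- **A KEY READING** (the dial): per tuple `(F, θ, hP, g₀, os)` and per step `K`, an endo-map of node U5d's σ-packed coupling-free keys — a COARSENING of the class key.
The TYPE only. [bookkeeping] -/
abbrev KeyReading₁₃ (N : ℕ) [NeZero N] (K₀ : ℕ) : Type 1 :=
  (F : T4Family) → (θ : Stage13HParams F N) → θ.Provisos₁₃CoPH F N → (ℕ → ℝ) → List (ULoop F) →
    ℕ → (Σ K, SiteSeqKey F (K₀ + K)) → (Σ K, SiteSeqKey F (K₀ + K))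
/-- **A BAD-KEY READING**: per tuple and per step, a predicate on keys — the bad class READ AT THE COARSE KEY (generalises the level policy `jcut` of `badClass₁₃`).
The TYPE only. [bookkeeping] -/
abbrev BadKeyReading₁₃ (N : ℕ) [NeZero N] (K₀ : ℕ) : Type 1 :=
  (F : T4Family) → (θ : Stage13HParams F N) → θ.Provisos₁₃CoPH F N → (ℕ → ℝ) → List (ULoop F) → ℕ → (Σ K, SiteSeqKey F (K₀ + K)) → Prop
/-- **A FLOOR READING**: per tuple, a level per step (the text of v5's `CutReading`; here read as the window FLOOR). The TYPE only. [bookkeeping] -/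
abbrev FloorReading₁₃ (N : ℕ) [NeZero N] : Type 1 :=
  (F : T4Family) → (θ : Stage13HParams F N) → θ.Provisos₁₃CoPH F N → (ℕ → ℝ) → List (ULoop F) → ℕ → ℕ
section Data
variable (θ : Stage13HParams F N) (hP : θ.Provisos₁₃CoPH F N) (K₀ : ℕ) (g₀ : ℕ → ℝ) (os : List (ULoop F))
  (kr : ℕ → (Σ K, SiteSeqKey F (K₀ + K)) → (Σ K, SiteSeqKey F (K₀ + K))) (bd : ℕ → (Σ K, SiteSeqKey F (K₀ + K)) → Prop)
/-- **THE COARSE CLASS SET**: the image of the class set of record under the dial. [bookkeeping] -/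
def classSetK₁₃ (K : ℕ) : Finset (Σ K, SiteSeqKey F (K₀ + K)) :=
  letI : ∀ Kc, DecidableEq (SiteSeqKey F Kc) := fun _ => Classical.decEq _
  (classSet₁₃ θ K₀ g₀ K).image (kr K)
/-- **RUN A's COARSE CLASS WEIGHT**: the partial sum of `weightA₁₃` over the dial's fibre (node U5d's `classVal`). [bookkeeping] -/
def weightAK₁₃ (K : ℕ) (t : ℝ) (u : Σ K, SiteSeqKey F (K₀ + K)) : ℝ :=
  letI : ∀ Kc, DecidableEq (SiteSeqKey F Kc) := fun _ => Classical.decEq _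
  classVal (classSet₁₃ θ K₀ g₀) kr (weightA₁₃ θ hP K₀ g₀ os) K t u
/-- **RUN B's COARSE CLASS WEIGHT**: the partial sum of `weightB₁₃` over the dial's fibre. [bookkeeping] -/
def weightBK₁₃ (K : ℕ) (t : ℝ) (u : Σ K, SiteSeqKey F (K₀ + K)) : ℝ :=
  letI : ∀ Kc, DecidableEq (SiteSeqKey F Kc) := fun _ => Classical.decEq _
  classVal (classSet₁₃ θ K₀ g₀) kr (weightB₁₃ θ hP K₀ g₀ os) K t u
/-- **THE COARSE BAD CLASS**: the coarse classes the bad-key reading selects (classical decidability, as `Node00.badKeysSigma`). [bookkeeping] -/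
def badClassK₁₃ (K : ℕ) (_t : ℝ) : Finset (Σ K, SiteSeqKey F (K₀ + K)) :=
  @Finset.filter _ (bd K) (fun _ => Classical.propDecidable _) (classSetK₁₃ θ K₀ g₀ kr K)
/-- A class of record reads INTO the coarse class set. [bookkeeping] -/
theorem kr_mem_classSetK₁₃ {K : ℕ} {x : Σ K, SiteSeqKey F (K₀ + K)} (hx : x ∈ classSet₁₃ θ K₀ g₀ K) : kr K x ∈ classSetK₁₃ θ K₀ g₀ kr K := by
  letI : ∀ Kc, DecidableEq (SiteSeqKey F Kc) := fun _ => Classical.decEq _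
  exact Finset.mem_image_of_mem _ hx
/-- Membership in the coarse bad class. [bookkeeping] -/
theorem mem_badClassK₁₃_iff (K : ℕ) (t : ℝ) (u : Σ K, SiteSeqKey F (K₀ + K)) :
    u ∈ badClassK₁₃ θ K₀ g₀ kr bd K t ↔ u ∈ classSetK₁₃ θ K₀ g₀ kr K ∧ bd K u := by
  unfold badClassK₁₃
  exact @Finset.mem_filter _ (bd K) (fun _ => Classical.propDecidable _) _ _
/-- The coarse bad class consists of coarse classes (the `bad_subset` clause, every step and source). [bookkeeping] -/
theorem badClassK₁₃_subset (K : ℕ) (t : ℝ) : badClassK₁₃ θ K₀ g₀ kr bd K t ⊆ classSetK₁₃ θ K₀ g₀ kr K := fun u hu =>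
  ((mem_badClassK₁₃_iff θ K₀ g₀ kr bd K t u).1 hu).1
/-- Run A's coarse class weight, unfolded: the sum of `weightA₁₃` over the classes of record reading to `u`. [bookkeeping] -/
theorem weightAK₁₃_eq_sum_filter (K : ℕ) (t : ℝ) (u : Σ K, SiteSeqKey F (K₀ + K)) :
    weightAK₁₃ θ hP K₀ g₀ os kr K t u =
      letI : ∀ Kc, DecidableEq (SiteSeqKey F Kc) := fun _ => Classical.decEq _
      ∑ x ∈ (classSet₁₃ θ K₀ g₀ K).filter (fun x => kr K x = u), weightA₁₃ θ hP K₀ g₀ os K t x :=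
  rfl
/-- Run B's coarse class weight, unfolded. [bookkeeping] -/
theorem weightBK₁₃_eq_sum_filter (K : ℕ) (t : ℝ) (u : Σ K, SiteSeqKey F (K₀ + K)) :
    weightBK₁₃ θ hP K₀ g₀ os kr K t u =
      letI : ∀ Kc, DecidableEq (SiteSeqKey F Kc) := fun _ => Classical.decEq _
      ∑ x ∈ (classSet₁₃ θ K₀ g₀ K).filter (fun x => kr K x = u), weightB₁₃ θ hP K₀ g₀ os K t x :=
  rfl
end Data
/-- **THE SPINE READING OF RECORD WITH A KEY-READING DIAL AT OFFSET `K₀`**: the record's runs ∕ keys ∕ fine weights read at the coarse key `kr`, the bad class read by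
`bd` at the coarse key, the shell split at the reading's key, canonical weights ∕ rate, `l₀ := 1`, `vol := F.side ^ 4`. [bookkeeping] -/
def crOfRecord₁₃KAt (K₀ : ℕ) (kr : KeyReading₁₃ N K₀) (bd : BadKeyReading₁₃ N K₀) (sh : ShellSplit₁₃CoPH N K₀) : SpineReading₁₃CoPH N := fun F θ hP g₀ os =>
  { ι := Σ K, SiteSeqKey F (K₀ + K)
    dec := Classical.decEq _
    l₀ := 1
    vol := F.side ^ 4
    K₀ := K₀
    T := classSetK₁₃ θ K₀ g₀ (kr F θ hP g₀ os)
    A := weightAK₁₃ θ hP K₀ g₀ os (kr F θ hP g₀ os)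
    B := weightBK₁₃ θ hP K₀ g₀ os (kr F θ hP g₀ os)
    shA := (sh F θ hP g₀ os).1
    shB := (sh F θ hP g₀ os).2
    Bad := badClassK₁₃ θ K₀ g₀ (kr F θ hP g₀ os) (bd F θ hP g₀ os)
    W := wInf 1 (classSetK₁₃ θ K₀ g₀ (kr F θ hP g₀ os)) (weightAK₁₃ θ hP K₀ g₀ os (kr F θ hP g₀ os)) (weightBK₁₃ θ hP K₀ g₀ os (kr F θ hP g₀ os))
      (badClassK₁₃ θ K₀ g₀ (kr F θ hP g₀ os) (bd F θ hP g₀ os))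
    Wsh := wshInf 1 (classSetK₁₃ θ K₀ g₀ (kr F θ hP g₀ os)) (weightAK₁₃ θ hP K₀ g₀ os (kr F θ hP g₀ os)) (weightBK₁₃ θ hP K₀ g₀ os (kr F θ hP g₀ os))
      (sh F θ hP g₀ os).1 (sh F θ hP g₀ os).2
    δ := letI : DecidableEq (Σ K, SiteSeqKey F (K₀ + K)) := Classical.decEq _
      deltaCan 1 (F.side ^ 4) (classSetK₁₃ θ K₀ g₀ (kr F θ hP g₀ os)) (badClassK₁₃ θ K₀ g₀ (kr F θ hP g₀ os) (bd F θ hP g₀ os))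
        (fun K t u => weightAK₁₃ θ hP K₀ g₀ os (kr F θ hP g₀ os) K t u - (sh F θ hP g₀ os).1 K t u)
        (fun K t u => weightBK₁₃ θ hP K₀ g₀ os (kr F θ hP g₀ os) K t u - (sh F θ hP g₀ os).2 K t u) }
/-- ★★ **THE SPINE READING OF RECORD WITH A KEY-READING DIAL**: `crOfRecord₁₃K := crOfRecord₁₃KAt 0`. [bookkeeping] -/
def crOfRecord₁₃K (kr : KeyReading₁₃ N 0) (bd : BadKeyReading₁₃ N 0) (sh : ShellSplit₁₃CoPH N 0) : SpineReading₁₃CoPH N :=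
  crOfRecord₁₃KAt 0 kr bd sh

/-! ## §2 The dictionary (all `rfl`) -/
section Dictionary
variable (K₀ : ℕ) (kr : KeyReading₁₃ N K₀) (bd : BadKeyReading₁₃ N K₀) (sh : ShellSplit₁₃CoPH N K₀) (θ : Stage13HParams F N) (hP : θ.Provisos₁₃CoPH F N)
  (g₀ : ℕ → ℝ) (os : List (ULoop F))
/-- `ι` — the σ-packed keys (the coarse classes live in the same key space). [bookkeeping] -/
theorem crOfRecord₁₃KAt_ι : (crOfRecord₁₃KAt K₀ kr bd sh F θ hP g₀ os).ι = (Σ K, SiteSeqKey F (K₀ + K)) := rfl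
/-- `l₀ = 1`. [bookkeeping] -/
@[simp] theorem crOfRecord₁₃KAt_l₀ : (crOfRecord₁₃KAt K₀ kr bd sh F θ hP g₀ os).l₀ = 1 := rfl
/-- `vol = F.side ^ 4`. [bookkeeping] -/
theorem crOfRecord₁₃KAt_vol : (crOfRecord₁₃KAt K₀ kr bd sh F θ hP g₀ os).vol = F.side ^ 4 := rfl
/-- `K₀`. [bookkeeping] -/
@[simp] theorem crOfRecord₁₃KAt_K₀ : (crOfRecord₁₃KAt K₀ kr bd sh F θ hP g₀ os).K₀ = K₀ := rfl
/-- `T` = the coarse class set. [bookkeeping] -/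
theorem crOfRecord₁₃KAt_T : (crOfRecord₁₃KAt K₀ kr bd sh F θ hP g₀ os).T = classSetK₁₃ θ K₀ g₀ (kr F θ hP g₀ os) := rfl
/-- `A` = run A's coarse class weights. [bookkeeping] -/
theorem crOfRecord₁₃KAt_A : (crOfRecord₁₃KAt K₀ kr bd sh F θ hP g₀ os).A = weightAK₁₃ θ hP K₀ g₀ os (kr F θ hP g₀ os) := rfl
/-- `B` = run B's coarse class weights. [bookkeeping] -/
theorem crOfRecord₁₃KAt_B : (crOfRecord₁₃KAt K₀ kr bd sh F θ hP g₀ os).B = weightBK₁₃ θ hP K₀ g₀ os (kr F θ hP g₀ os) := rfl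
/-- `Bad` = the coarse bad class. [bookkeeping] -/
theorem crOfRecord₁₃KAt_Bad : (crOfRecord₁₃KAt K₀ kr bd sh F θ hP g₀ os).Bad = badClassK₁₃ θ K₀ g₀ (kr F θ hP g₀ os) (bd F θ hP g₀ os) := rfl
/-- `shA`. [bookkeeping] -/
theorem crOfRecord₁₃KAt_shA : (crOfRecord₁₃KAt K₀ kr bd sh F θ hP g₀ os).shA = (sh F θ hP g₀ os).1 := rfl
/-- `shB`. [bookkeeping] -/
theorem crOfRecord₁₃KAt_shB : (crOfRecord₁₃KAt K₀ kr bd sh F θ hP g₀ os).shB = (sh F θ hP g₀ os).2 := rfl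
/-- `W` = the canonical least relative weight of the coarse bad class. [bookkeeping] -/
theorem crOfRecord₁₃KAt_W : (crOfRecord₁₃KAt K₀ kr bd sh F θ hP g₀ os).W =
    wInf 1 (classSetK₁₃ θ K₀ g₀ (kr F θ hP g₀ os)) (weightAK₁₃ θ hP K₀ g₀ os (kr F θ hP g₀ os)) (weightBK₁₃ θ hP K₀ g₀ os (kr F θ hP g₀ os))
      (badClassK₁₃ θ K₀ g₀ (kr F θ hP g₀ os) (bd F θ hP g₀ os)) := rfl
/-- `Wsh` = the canonical relative shell weight at the coarse carriers. [bookkeeping] -/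
theorem crOfRecord₁₃KAt_Wsh : (crOfRecord₁₃KAt K₀ kr bd sh F θ hP g₀ os).Wsh =
    wshInf 1 (classSetK₁₃ θ K₀ g₀ (kr F θ hP g₀ os)) (weightAK₁₃ θ hP K₀ g₀ os (kr F θ hP g₀ os)) (weightBK₁₃ θ hP K₀ g₀ os (kr F θ hP g₀ os))
      (sh F θ hP g₀ os).1 (sh F θ hP g₀ os).2 := rfl
/-- `δ` = the canonical rate at the physical volume. [bookkeeping] -/
theorem crOfRecord₁₃KAt_δ : (crOfRecord₁₃KAt K₀ kr bd sh F θ hP g₀ os).δ =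
    (letI : DecidableEq (Σ K, SiteSeqKey F (K₀ + K)) := Classical.decEq _
     deltaCan 1 (F.side ^ 4) (classSetK₁₃ θ K₀ g₀ (kr F θ hP g₀ os)) (badClassK₁₃ θ K₀ g₀ (kr F θ hP g₀ os) (bd F θ hP g₀ os))
      (fun K t u => weightAK₁₃ θ hP K₀ g₀ os (kr F θ hP g₀ os) K t u - (sh F θ hP g₀ os).1 K t u)
      (fun K t u => weightBK₁₃ θ hP K₀ g₀ os (kr F θ hP g₀ os) K t u - (sh F θ hP g₀ os).2 K t u)) := rfl
/-- The record object reads the offset-`0` form (`rfl`). [bookkeeping] -/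
theorem crOfRecord₁₃K_eq (kr : KeyReading₁₃ N 0) (bd : BadKeyReading₁₃ N 0) (sh : ShellSplit₁₃CoPH N 0) : crOfRecord₁₃K kr bd sh = crOfRecord₁₃KAt 0 kr bd sh := rfl
end Dictionary

/-! ## §3 Re-keying preserves the totals; the extraction face at EVERY key reading; the bad mass at the coarse key -/
section Totals
variable (θ : Stage13HParams F N) (hP : θ.Provisos₁₃CoPH F N) (K₀ : ℕ) (g₀ : ℕ → ℝ) (os : List (ULoop F))
  (kr : ℕ → (Σ K, SiteSeqKey F (K₀ + K)) → (Σ K, SiteSeqKey F (K₀ + K))) (bd : ℕ → (Σ K, SiteSeqKey F (K₀ + K)) → Prop)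
/-- ★ **RE-KEYING PRESERVES RUN A's TOTAL**: `Σ_{coarse classes} weightAK₁₃ = Σ_{classes of record} weightA₁₃` (node U5d: partial summation loses nothing). [bookkeeping] -/
theorem sum_weightAK₁₃_eq (K : ℕ) (t : ℝ) :
    ∑ u ∈ classSetK₁₃ θ K₀ g₀ kr K, weightAK₁₃ θ hP K₀ g₀ os kr K t u = ∑ x ∈ classSet₁₃ θ K₀ g₀ K, weightA₁₃ θ hP K₀ g₀ os K t x := by
  letI : ∀ Kc, DecidableEq (SiteSeqKey F Kc) := fun _ => Classical.decEq _
  exact sum_classVal (T := classSetK₁₃ θ K₀ g₀ kr) (fun x hx => kr_mem_classSetK₁₃ θ K₀ g₀ kr hx) t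
/-- ★ **RE-KEYING PRESERVES RUN B's TOTAL**. [bookkeeping] -/
theorem sum_weightBK₁₃_eq (K : ℕ) (t : ℝ) :
    ∑ u ∈ classSetK₁₃ θ K₀ g₀ kr K, weightBK₁₃ θ hP K₀ g₀ os kr K t u = ∑ x ∈ classSet₁₃ θ K₀ g₀ K, weightB₁₃ θ hP K₀ g₀ os K t x := by
  letI : ∀ Kc, DecidableEq (SiteSeqKey F Kc) := fun _ => Classical.decEq _
  exact sum_classVal (T := classSetK₁₃ θ K₀ g₀ kr) (fun x hx => kr_mem_classSetK₁₃ θ K₀ g₀ kr hx) t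
/-- **THE BAD MASS AT THE COARSE KEY** (run A): the coarse bad classes weigh exactly the classes of record whose coarse key is bad — the quantity an NE7b estimate at the
coarse key books. [bookkeeping] -/
theorem sum_bad_weightAK₁₃_eq (K : ℕ) (t : ℝ) :
    ∑ u ∈ badClassK₁₃ θ K₀ g₀ kr bd K t, weightAK₁₃ θ hP K₀ g₀ os kr K t u =
      letI : ∀ Kc, DecidableEq (SiteSeqKey F Kc) := fun _ => Classical.decEq _
      ∑ x ∈ (classSet₁₃ θ K₀ g₀ K).filter (fun x => kr K x ∈ badClassK₁₃ θ K₀ g₀ kr bd K t), weightA₁₃ θ hP K₀ g₀ os K t x := by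
  letI : ∀ Kc, DecidableEq (SiteSeqKey F Kc) := fun _ => Classical.decEq _
  exact sum_classVal_eq_filter K _ t
/-- The bad mass at the coarse key (run B). [bookkeeping] -/
theorem sum_bad_weightBK₁₃_eq (K : ℕ) (t : ℝ) :
    ∑ u ∈ badClassK₁₃ θ K₀ g₀ kr bd K t, weightBK₁₃ θ hP K₀ g₀ os kr K t u =
      letI : ∀ Kc, DecidableEq (SiteSeqKey F Kc) := fun _ => Classical.decEq _
      ∑ x ∈ (classSet₁₃ θ K₀ g₀ K).filter (fun x => kr K x ∈ badClassK₁₃ θ K₀ g₀ kr bd K t), weightB₁₃ θ hP K₀ g₀ os K t x := by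
  letI : ∀ Kc, DecidableEq (SiteSeqKey F Kc) := fun _ => Classical.decEq _
  exact sum_classVal_eq_filter K _ t
/-- Non-negativity transports to the coarse weights (run A). [bookkeeping] -/
theorem weightAK₁₃_nonneg {K : ℕ} {t : ℝ} (h : ∀ x ∈ classSet₁₃ θ K₀ g₀ K, 0 ≤ weightA₁₃ θ hP K₀ g₀ os K t x) (u : Σ K, SiteSeqKey F (K₀ + K)) :
    0 ≤ weightAK₁₃ θ hP K₀ g₀ os kr K t u := by
  letI : ∀ Kc, DecidableEq (SiteSeqKey F Kc) := fun _ => Classical.decEq _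
  exact classVal_nonneg h u
/-- Non-negativity transports to the coarse weights (run B). [bookkeeping] -/
theorem weightBK₁₃_nonneg {K : ℕ} {t : ℝ} (h : ∀ x ∈ classSet₁₃ θ K₀ g₀ K, 0 ≤ weightB₁₃ θ hP K₀ g₀ os K t x) (u : Σ K, SiteSeqKey F (K₀ + K)) :
    0 ≤ weightBK₁₃ θ hP K₀ g₀ os kr K t u := by
  letI : ∀ Kc, DecidableEq (SiteSeqKey F Kc) := fun _ => Classical.decEq _
  exact classVal_nonneg h u
end Totals
section Extraction
variable (K₀ : ℕ) (kr : KeyReading₁₃ N K₀) (bd : BadKeyReading₁₃ N K₀) (sh : ShellSplit₁₃CoPH N K₀) (θ : Stage13HParams F N) (hP : θ.Provisos₁₃CoPH F N)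
  (E : B12.RunParams → ℝ)
/-- ★★ **THE EXTRACTION FACE OF K3⁷ AT EVERY KEY READING IS A THEOREM** under the live-selector pin and B‴'s three laws (the V edition's hypotheses verbatim): `0 < l₀`,
`0 < vol`, and E1 ∕ E2 — the partition functions of the two runs are the totals of the COARSE class weights, whatever the dial. [bookkeeping] -/
theorem keyedExtraction_crOfRecord₁₃KAt (hsel : θ.ppSel = ppSelLiveOfRecord F N θ.ν θ.τ9 E (wOfRecord₉ F N θ.toStage9Params))
    (hU : LocalBgMeasurable F N θ.ν) (hζm : ZetaMeasurable F N θ.ζ) (hζ0 : ∀ p g k s Pl Ql RS U V', 0 ≤ θ.ζ p g k s Pl Ql RS U V') :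
    ForSmallCouplings (datumOfRecord₁₃CoPH F N θ hP) fun g₀ => ∀ os : List (ULoop F),
      0 < (crOfRecord₁₃KAt K₀ kr bd sh F θ hP g₀ os).l₀ ∧ 0 < (crOfRecord₁₃KAt K₀ kr bd sh F θ hP g₀ os).vol ∧
      (∀ (K : ℕ) (t : ℝ), |t| ≤ (crOfRecord₁₃KAt K₀ kr bd sh F θ hP g₀ os).l₀ →
        T4GenFunBounds.schemeZ ((datumOfRecord₁₃CoPH F N θ hP).scheme g₀) os ((crOfRecord₁₃KAt K₀ kr bd sh F θ hP g₀ os).K₀ + K) t =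
          ∑ τ ∈ (crOfRecord₁₃KAt K₀ kr bd sh F θ hP g₀ os).T K, (crOfRecord₁₃KAt K₀ kr bd sh F θ hP g₀ os).A K t τ) ∧
      (∀ (K : ℕ) (t : ℝ), |t| ≤ (crOfRecord₁₃KAt K₀ kr bd sh F θ hP g₀ os).l₀ →
        T4GenFunBounds.schemeZ ((datumOfRecord₁₃CoPH F N θ hP).scheme g₀) os ((crOfRecord₁₃KAt K₀ kr bd sh F θ hP g₀ os).K₀ + K + 1) t =
          ∑ τ ∈ (crOfRecord₁₃KAt K₀ kr bd sh F θ hP g₀ os).T K, (crOfRecord₁₃KAt K₀ kr bd sh F θ hP g₀ os).B K t τ) :=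
  ForSmallCouplings.of_forall fun g₀ os =>
    ⟨one_pos, pow_pos F.side_pos 4,
      fun K t _ => (schemeZ_eq_sum_classSet_weightA K₀ θ hP E hsel hU hζm hζ0 g₀ os K t).trans (sum_weightAK₁₃_eq θ hP K₀ g₀ os (kr F θ hP g₀ os) K t).symm,
      fun K t _ => (schemeZ_succ_eq_sum_classSet_weightB K₀ θ hP E hsel hU hζm hζ0 g₀ os K t).trans (sum_weightBK₁₃_eq θ hP K₀ g₀ os (kr F θ hP g₀ os) K t).symm⟩
end Extraction

/-! ## §4 Face transfers at the keyed-dial reading (the canonical weights inherit any witness at the coarse carriers) -/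
section Transfer
variable (K₀ : ℕ) (kr : KeyReading₁₃ N K₀) (bd : BadKeyReading₁₃ N K₀) (sh : ShellSplit₁₃CoPH N K₀) (θ : Stage13HParams F N) (hP : θ.Provisos₁₃CoPH F N)
  (g₀ : ℕ → ℝ) (os : List (ULoop F))
/-- ★ **N20 AT THE KEYED-DIAL READING FROM ANY WITNESS at the coarse carriers**. [bookkeeping] -/
theorem relWeightBound_crOfRecord₁₃KAt {W : ℕ → ℝ}
    (h : RelWeightBound 1 (classSetK₁₃ θ K₀ g₀ (kr F θ hP g₀ os)) (weightAK₁₃ θ hP K₀ g₀ os (kr F θ hP g₀ os)) (weightBK₁₃ θ hP K₀ g₀ os (kr F θ hP g₀ os))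
      (badClassK₁₃ θ K₀ g₀ (kr F θ hP g₀ os) (bd F θ hP g₀ os)) W) :
    RelWeightBound (crOfRecord₁₃KAt K₀ kr bd sh F θ hP g₀ os).l₀ (crOfRecord₁₃KAt K₀ kr bd sh F θ hP g₀ os).T (crOfRecord₁₃KAt K₀ kr bd sh F θ hP g₀ os).A
      (crOfRecord₁₃KAt K₀ kr bd sh F θ hP g₀ os).B (crOfRecord₁₃KAt K₀ kr bd sh F θ hP g₀ os).Bad (crOfRecord₁₃KAt K₀ kr bd sh F θ hP g₀ os).W :=
  relWeightBound_wInf h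
/-- ★ **N21 AT THE KEYED-DIAL READING FROM ANY WITNESS**. [bookkeeping] -/
theorem shellWeightBound_crOfRecord₁₃KAt {Wsh : ℕ → ℝ}
    (h : ShellWeightBound 1 (classSetK₁₃ θ K₀ g₀ (kr F θ hP g₀ os)) (weightAK₁₃ θ hP K₀ g₀ os (kr F θ hP g₀ os)) (weightBK₁₃ θ hP K₀ g₀ os (kr F θ hP g₀ os))
      (sh F θ hP g₀ os).1 (sh F θ hP g₀ os).2 Wsh) :
    ShellWeightBound (crOfRecord₁₃KAt K₀ kr bd sh F θ hP g₀ os).l₀ (crOfRecord₁₃KAt K₀ kr bd sh F θ hP g₀ os).T (crOfRecord₁₃KAt K₀ kr bd sh F θ hP g₀ os).A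
      (crOfRecord₁₃KAt K₀ kr bd sh F θ hP g₀ os).B (crOfRecord₁₃KAt K₀ kr bd sh F θ hP g₀ os).shA (crOfRecord₁₃KAt K₀ kr bd sh F θ hP g₀ os).shB
      (crOfRecord₁₃KAt K₀ kr bd sh F θ hP g₀ os).Wsh :=
  shellWeightBound_wshInf h
/-- ★ **N19′'s CORE AND U4′'s SUMMABILITY AT THE READING's OWN RATE FROM ANY WITNESS at the coarse carriers** (sandwich at volume `F.side ^ 4`). [bookkeeping] -/
theorem core_crOfRecord₁₃KAt {δ : ℕ → ℝ}
    (hP0 : letI : DecidableEq (Σ K, SiteSeqKey F (K₀ + K)) := Classical.decEq _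
      ∀ (K : ℕ) (t : ℝ), |t| ≤ 1 → ∀ u ∈ classSetK₁₃ θ K₀ g₀ (kr F θ hP g₀ os) K \ badClassK₁₃ θ K₀ g₀ (kr F θ hP g₀ os) (bd F θ hP g₀ os) K t,
        0 ≤ weightAK₁₃ θ hP K₀ g₀ os (kr F θ hP g₀ os) K t u - (sh F θ hP g₀ os).1 K t u)
    (h : letI : DecidableEq (Σ K, SiteSeqKey F (K₀ + K)) := Classical.decEq _
      NE7.Core 1 (F.side ^ 4) (classSetK₁₃ θ K₀ g₀ (kr F θ hP g₀ os)) (badClassK₁₃ θ K₀ g₀ (kr F θ hP g₀ os) (bd F θ hP g₀ os))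
        (fun K t u => weightAK₁₃ θ hP K₀ g₀ os (kr F θ hP g₀ os) K t u - (sh F θ hP g₀ os).1 K t u)
        (fun K t u => weightBK₁₃ θ hP K₀ g₀ os (kr F θ hP g₀ os) K t u - (sh F θ hP g₀ os).2 K t u) δ)
    (hδ : Summable δ) :
    (letI := (crOfRecord₁₃KAt K₀ kr bd sh F θ hP g₀ os).dec
     NE7.Core (crOfRecord₁₃KAt K₀ kr bd sh F θ hP g₀ os).l₀ (crOfRecord₁₃KAt K₀ kr bd sh F θ hP g₀ os).vol (crOfRecord₁₃KAt K₀ kr bd sh F θ hP g₀ os).T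
      (crOfRecord₁₃KAt K₀ kr bd sh F θ hP g₀ os).Bad
      (fun K t τ => (crOfRecord₁₃KAt K₀ kr bd sh F θ hP g₀ os).A K t τ - (crOfRecord₁₃KAt K₀ kr bd sh F θ hP g₀ os).shA K t τ)
      (fun K t τ => (crOfRecord₁₃KAt K₀ kr bd sh F θ hP g₀ os).B K t τ - (crOfRecord₁₃KAt K₀ kr bd sh F θ hP g₀ os).shB K t τ)
      (crOfRecord₁₃KAt K₀ kr bd sh F θ hP g₀ os).δ) ∧ Summable (crOfRecord₁₃KAt K₀ kr bd sh F θ hP g₀ os).δ := by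
  letI : DecidableEq (Σ K, SiteSeqKey F (K₀ + K)) := Classical.decEq _
  letI := (crOfRecord₁₃KAt K₀ kr bd sh F θ hP g₀ os).dec
  exact ⟨core_deltaCan (pow_pos F.side_pos 4).le hP0 h, summable_deltaCan (pow_pos F.side_pos 4).le hP0 h hδ⟩
/-- **U4′'s `W + Wsh < 1` AT THE KEYED-DIAL READING FROM ANY WITNESSES**. [bookkeeping] -/
theorem lt_one_crOfRecord₁₃KAt {W Wsh : ℕ → ℝ}
    (hW : RelWeightBound 1 (classSetK₁₃ θ K₀ g₀ (kr F θ hP g₀ os)) (weightAK₁₃ θ hP K₀ g₀ os (kr F θ hP g₀ os)) (weightBK₁₃ θ hP K₀ g₀ os (kr F θ hP g₀ os))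
      (badClassK₁₃ θ K₀ g₀ (kr F θ hP g₀ os) (bd F θ hP g₀ os)) W)
    (hSh : ShellWeightBound 1 (classSetK₁₃ θ K₀ g₀ (kr F θ hP g₀ os)) (weightAK₁₃ θ hP K₀ g₀ os (kr F θ hP g₀ os)) (weightBK₁₃ θ hP K₀ g₀ os (kr F θ hP g₀ os))
      (sh F θ hP g₀ os).1 (sh F θ hP g₀ os).2 Wsh)
    (hlt : ∀ K, W K + Wsh K < 1) (K : ℕ) :
    (crOfRecord₁₃KAt K₀ kr bd sh F θ hP g₀ os).W K + (crOfRecord₁₃KAt K₀ kr bd sh F θ hP g₀ os).Wsh K < 1 :=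
  wInf_add_wshInf_lt_one hW hSh hlt K
end Transfer

/-! ## §5 The identity dial with the level-cut bad reading IS the pinned record -/
/-- **THE IDENTITY DIAL**: every key reads as itself (v5's pin). [bookkeeping] -/
def keyReadingId₁₃ (N : ℕ) [NeZero N] (K₀ : ℕ) : KeyReading₁₃ N K₀ := fun _ _ _ _ _ _ x => x
/-- **THE LEVEL-CUT BAD READING** of a policy `jcut : ℕ → ℕ`: «an old large-field region at a level `≤ jcut` of the key's own step» — `badClass₁₃`'s predicate. [bookkeeping] -/
def badKeyReadingOfCut₁₃ (N : ℕ) [NeZero N] (K₀ : ℕ) (jcut : ℕ → ℕ) : BadKeyReading₁₃ N K₀ := fun _F _ _ _ _ _ x => KeyOldLargeField (jcut x.1) x.2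
section Identity
variable (θ : Stage13HParams F N) (hP : θ.Provisos₁₃CoPH F N) (K₀ : ℕ) (g₀ : ℕ → ℝ) (os : List (ULoop F)) (jcut : ℕ → ℕ)
/-- At the identity dial the coarse class set IS the class set of record. [bookkeeping] -/
theorem classSetK₁₃_id : classSetK₁₃ θ K₀ g₀ (fun _ x => x) = classSet₁₃ θ K₀ g₀ := by
  letI : ∀ Kc, DecidableEq (SiteSeqKey F Kc) := fun _ => Classical.decEq _
  funext K
  exact Finset.image_id'
/-- At the identity dial run A's coarse weight IS `weightA₁₃` (off the class set both vanish: no index reads to such a key). [bookkeeping] -/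
theorem weightAK₁₃_id : weightAK₁₃ θ hP K₀ g₀ os (fun _ x => x) = weightA₁₃ θ hP K₀ g₀ os := by
  letI : ∀ Kc, DecidableEq (SiteSeqKey F Kc) := fun _ => Classical.decEq _
  funext K t u
  rw [weightAK₁₃_eq_sum_filter]
  by_cases hu : u ∈ classSet₁₃ θ K₀ g₀ K
  · rw [Finset.filter_eq' _ u, if_pos hu, Finset.sum_singleton]
  · rw [Finset.filter_eq' _ u, if_neg hu, Finset.sum_empty]
    refine (Finset.sum_eq_zero fun s hs => ?_).symm
    exact (hu ((Finset.mem_filter.mp hs).2 ▸ Finset.mem_union_left _ (Finset.mem_image_of_mem _ (Finset.mem_univ s)))).elim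
/-- At the identity dial run B's coarse weight IS `weightB₁₃`. [bookkeeping] -/
theorem weightBK₁₃_id : weightBK₁₃ θ hP K₀ g₀ os (fun _ x => x) = weightB₁₃ θ hP K₀ g₀ os := by
  letI : ∀ Kc, DecidableEq (SiteSeqKey F Kc) := fun _ => Classical.decEq _
  funext K t u
  rw [weightBK₁₃_eq_sum_filter]
  by_cases hu : u ∈ classSet₁₃ θ K₀ g₀ K
  · rw [Finset.filter_eq' _ u, if_pos hu, Finset.sum_singleton]
  · rw [Finset.filter_eq' _ u, if_neg hu, Finset.sum_empty]
    refine (Finset.sum_eq_zero fun s' hs => ?_).symm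
    exact (hu ((Finset.mem_filter.mp hs).2 ▸ Finset.mem_union_right _ (Finset.mem_image_of_mem _ (Finset.mem_univ s')))).elim
/-- At the identity dial with the level-cut bad reading the coarse bad class IS `badClass₁₃ … jcut`. [bookkeeping] -/
theorem badClassK₁₃_id : badClassK₁₃ θ K₀ g₀ (fun _ x => x) (fun _ x => KeyOldLargeField (jcut x.1) x.2) = badClass₁₃ θ K₀ g₀ jcut := by
  funext K t
  rw [badClassK₁₃, classSetK₁₃_id]
  rfl
/-- ★ **THE PINNED RECORD IS THE IDENTITY-DIAL INSTANCE**: `crOfRecord₁₃KAt K₀ (keyReadingId₁₃ N K₀) (badKeyReadingOfCut₁₃ N K₀ jcut) sh = crOfRecord₁₃VAt K₀ jcut sh` —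
so a `PinnedAtLive`-with-dial at `kr := keyReadingId₁₃`, `bd := badKeyReadingOfCut₁₃ … (jc …)` is v5's pin verbatim. [bookkeeping] -/
theorem crOfRecord₁₃KAt_id (sh : ShellSplit₁₃CoPH N K₀) :
    crOfRecord₁₃KAt K₀ (keyReadingId₁₃ N K₀) (badKeyReadingOfCut₁₃ N K₀ jcut) sh = crOfRecord₁₃VAt K₀ jcut sh := by
  funext F θ hP g₀ os
  show crOfRecord₁₃KAt K₀ (fun _ _ _ _ _ _ x => x) (fun _ _ _ _ _ _ x => KeyOldLargeField (jcut x.1) x.2) sh F θ hP g₀ os = _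
  simp only [crOfRecord₁₃KAt, crOfRecord₁₃VAt, classSetK₁₃_id, weightAK₁₃_id, weightBK₁₃_id, badClassK₁₃_id]
/-- … in particular at offset `0`: `crOfRecord₁₃K (keyReadingId₁₃ N 0) (badKeyReadingOfCut₁₃ N 0 jcut) sh = crOfRecord₁₃V jcut sh`. [bookkeeping] -/
theorem crOfRecord₁₃K_id (sh : ShellSplit₁₃CoPH N 0) :
    crOfRecord₁₃K (keyReadingId₁₃ N 0) (badKeyReadingOfCut₁₃ N 0 jcut) sh = crOfRecord₁₃V jcut sh :=
  crOfRecord₁₃KAt_id 0 jcut sh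
end Identity

/-! ## §6 The window value of the dial -/
/-- **THE LEVEL-WINDOW KEY READING** with floor reading `c`: every key reads as its level window at its own step's floor (`Node00.windowKeySigma`): the entries at the
levels `1 ≤ j ≤ c … K` are forgotten, the recent levels kept. [bookkeeping] -/
def windowKeyReading₁₃ (K₀ : ℕ) (c : FloorReading₁₃ N) : KeyReading₁₃ N K₀ := fun F θ hP g₀ os _ x => windowKeySigma F (c F θ hP g₀ os) x
section Window
variable (θ : Stage13HParams F N) (hP : θ.Provisos₁₃CoPH F N) (K₀ : ℕ) (g₀ : ℕ → ℝ) (os : List (ULoop F))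
/-- **FLOOR `0` IS THE IDENTITY DIAL** (the pinned record is the window reading with nothing forgotten). [bookkeeping] -/
theorem windowKeyReading₁₃_zero : windowKeyReading₁₃ (N := N) K₀ (fun _ _ _ _ _ _ => 0) = keyReadingId₁₃ N K₀ := by
  funext F θ hP g₀ os K x
  exact windowKeySigma_zero F x
/-- The window reading at floor `0` gives back the pinned record. [bookkeeping] -/
theorem crOfRecord₁₃KAt_window_zero (jcut : ℕ → ℕ) (sh : ShellSplit₁₃CoPH N K₀) :
    crOfRecord₁₃KAt K₀ (windowKeyReading₁₃ K₀ fun _ _ _ _ _ _ => 0) (badKeyReadingOfCut₁₃ N K₀ jcut) sh = crOfRecord₁₃VAt K₀ jcut sh := by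
  rw [windowKeyReading₁₃_zero, crOfRecord₁₃KAt_id]
/-- At the window dial with the level-cut bad reading the coarse bad class is `Node00.badKeysSigma` of the windowed class set (`rfl`). [bookkeeping] -/
theorem badClassK₁₃_window_eq_badKeysSigma (c jcut : ℕ → ℕ) (K : ℕ) (t : ℝ) :
    badClassK₁₃ θ K₀ g₀ (fun _ x => windowKeySigma F c x) (fun _ x => KeyOldLargeField (jcut x.1) x.2) K t =
      badKeysSigma F (classSetK₁₃ θ K₀ g₀ (fun _ x => windowKeySigma F c x) K) jcut :=
  rfl
/-- ★ **A LEVEL CUT AT OR BELOW THE FLOOR BOOKS NOTHING AT THE WINDOW KEY**: with `jcut K ≤ c K` at every step, the bad class of the window reading under the level-cut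
bad reading is EMPTY — at the window key a persistence policy of `badClass₁₃`'s kind sees only cuts ABOVE the floor. [bookkeeping] -/
theorem bad_window_eq_empty_of_cut_le_floor {c jcut : ℕ → ℕ} (h : ∀ K, jcut K ≤ c K) (K : ℕ) (t : ℝ) :
    badClassK₁₃ θ K₀ g₀ (fun _ x => windowKeySigma F c x) (fun _ x => KeyOldLargeField (jcut x.1) x.2) K t = ∅ := by
  letI : ∀ Kc, DecidableEq (SiteSeqKey F Kc) := fun _ => Classical.decEq _
  rw [badClassK₁₃_window_eq_badKeysSigma]
  exact badKeysSigma_image_windowKeySigma_eq_empty F _ h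
/-- The same at the reading: with the floor reading dominating the cut reading tuple by tuple, `(crOfRecord₁₃KAt K₀ (windowKeyReading₁₃ K₀ c) (cut jc) sh …).Bad K t = ∅`.
[bookkeeping] -/
theorem crOfRecord₁₃KAt_window_bad_eq_empty (c jc : FloorReading₁₃ N) (sh : ShellSplit₁₃CoPH N K₀)
    (h : ∀ K, jc F θ hP g₀ os K ≤ c F θ hP g₀ os K) (K : ℕ) (t : ℝ) :
    (crOfRecord₁₃KAt K₀ (windowKeyReading₁₃ K₀ c) (fun F θ hP g₀ os _ x => KeyOldLargeField (jc F θ hP g₀ os x.1) x.2) sh F θ hP g₀ os).Bad K t = ∅ :=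
  bad_window_eq_empty_of_cut_le_floor θ K₀ g₀ h K t
end Window

end YMDAG.UVSplit

end
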